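import Summits.QuantumFields.BalabanUV.T4Continuum.Support.ShellMeasureLiveEndOneCallSlotHistories
import Summits.QuantumFields.BalabanUV.T4Continuum.Support.ShellMeasureHistoriesTransport
import Summits.QuantumFields.BalabanUV.T4Continuum.Support.ShellMeasureThresholdUnitsHistories

/-!
# `T4Continuum.ShellMeasureLiveEndOneCallHistories` — row S103b «THE ONE CALL ON THE HISTORIES ROAD»: END-II (S99 f3b) per history on the slot's OWN
# layer (KEPT host, S99 f4) ∘ S103a's TRANSPORT to the comparison's common space ∘ the histories-road END-I with `LocalRate` BY NAME (S90 f3)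
(cell `pub-balaban`, sub-cell `t4`, NE7c (node U5b); crew unit `b2b-balaban-t4-ne7c-formalise-leaf-09` gen 13; owner table row **S103b** (R-ne7cp1-g35-6 (b):
OPEN, first refusal leaf-09 = the S92∕S95∕S102 generator, after S102 and S103a); imports file 1‴ `ShellMeasureLiveEndOneCallSlotHistories` (S99 f3b ∘ S90 per `(r,K,t,s,τ)`),
S103a `ShellMeasureHistoriesTransport` (leaf-08-g16: `hac_histories_of_layers`) and S90 f3 `ShellMeasureThresholdUnitsHistories` (owner:
`shellWeightBound_histories_age_of_localRate`) ONLY; [folklore]; 0 `def`, 0 `def … : Prop`, 0 sorry, 0 cite; END-II block generated by `gen103.py` mode `histL`)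

HONEST FRAMING.  Finite four-torus programme, rung (B)+1 only — NOT infinite volume, NOT a mass gap, NOT the Clay problem, NOT summit progress; (B),
`BetaPertHyp`, (B^μ) not consumed.  NE7c (`T4IndicatorShell.ShellWeightBound`) is NOT PRINTED in [Balaban 1983–89] and NOT PROVED; «NE7c ⇐ the named
binders» (trigger c3): every binder below is DISPLAYED, asserted by nobody; no estimate of Bałaban's is discharged; `LocalRate` is node U1b's NOT-PRINTED
output shape, consumed BY NAME (c4).  What this declaration changes is OUR bookkeeping: END-I's (R)+[dict] rows R23d (`T A B shA shB pieceA pieceB MA MB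
hFfin sh_nonneg… total_ge…`, class O in the owner's census) are PROVED by the histories road (S24∕S27-histories∕S90 f3) instead of displayed; what ENTERS
is the histories structure (`T C small lvl`, the history laws `ν r K t τ` on the common space `Ω K`, END-I's variables `v r K t s`), the LAYER READING maps
`π r K s : Ω K → GaugeField (P r K s) (jl r K s) SU2` with the reading `v = (u∕η²) ∘ π` and the identification `(histLaw …).map π = fieldMeasure.withDensity F`
per history ([O] — node O's dictionary; INHABITABLE by the designed objects because the layer measure is the KEPT one `𝟙{u∕η² < ε}·F` —
leaf-03-g8's N-ne7cleaf03g8-1 ∕ owner R-ne7cp1-g36-7 (b): `ShellMeasureHistoriesTransportKept.map_withDensity_tower_indicator`, KERNEL for the block-averaging tower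
under `HaarAC`), `LocalRate` + realisation identities + floor ([N]∕[O]).
HONEST DEPENDENCY (cell): continuum YM on T⁴ ⇐ BetaPertH ∧ nine spine estimates (0/9 proved); BetaPertH ⇐ (D1) ∧ (D4) ∧ CAP+tail; G-an2-4 gates asym,
D1 and NE2/3/4.

WHAT IS PROVED ([folklore]).  **`shellWeightBound_histories_oneCall_cfB7`**: for both runs `r` (A = `true`: `lvl K s` steps; B = `false`: one more step, by the realisation identities), END-II
(file 1‴, S99 f4 = f3b KEPT: R11 discharged, box host, per history `τ`) gives (M1) for the KEPT layer measure in threshold units (`{u < ε·η²} = {u∕η² < ε}`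
rewritten in-proof) at width `geomWidth Cr θmin ϑ (lvl K s)`
(displayed `hρg : geomWidth … ≤ (1−δ)∕2`) and the slot→level majorant `hDslot`; S103a `hac_histories_of_layers` transports it to the `s`-small PARTIAL LAW
on `Ω K`; S90 f3 closes `ShellWeightBound` with `LocalRate` BY NAME.  CONCLUSION LITERALLY S90 f3's: `ShellWeightBound l₀ T (histWeight …) (histWeight …)
(histShell …) (histShell …) (fun K => Σ_{s∈C K} D true (lvl K s)·geomWidth … + Σ D false …)`.  (x3‴): the owner's census re-run — R23d ABSENT; class T
must not rise (END-II's families are file 1‴'s = S102 f1″'s with the F-side objects history-indexed).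
-/

noncomputable section

open Set Metric NormedSpace MeasureTheory Function Finset
open scoped ENNReal

namespace Summit.QuantumFields.BalabanUV.T4Continuum.ShellMeasureLiveEndOneCallHistories

open Literature.MathematicalPhysics.QuantumFieldTheory.Balaban1983to89
open B11Prop6Scheme (Prop4Hyp)
open GaugeField (GaugeInvariant)
open T4IndicatorShell (ShellWeightBound)
open T4ShellMeasure (SlotAntiConcentration)
open T4ShellMeasureLevels (LiveWindow)
open T4ShellMeasureFibre (slotAntiConcentration_mono)
open T4EtaRateMin (Readings LocalRate)
open T4SupCloseLiaison (geomWidth geomWidth_nonneg)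
open T4CubePoincare (cube)
open T4CubeChartGnomonic (SU2)
open T4CubeChartExp (expFibreChart)
open T4TreeGaugeFixing (fixTo)
open T4AxialGaugeFixing (combBonds)
open T4AxialGaugeSmallField (boxPlaqs boxBonds)
open T4ShellMeasurePlaquette (expTail₂)
open ShellMeasureLevelAssembly (classifier)
open ShellMeasureMultiGridNorms (WSup)
open ShellMeasureMultiGridNorms.WSup (toPiL)
open ShellMeasurePinnedNorm (pinW)
open ShellMeasureDecayKernelSums (kerOp)
open ShellMeasureLandauHolonomy (solAt landauExp)
open ShellMeasureLandauHolonomyChart (holOf cplx)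
open ShellMeasureLandauHolonomySkew (readOutReal)
open B7Prop2Explicit (C0 c2' unitaryUnits)
open B7Prop1Local (pdevOn loK bondHiK)
open B7Prop5Flat (BondIn)
open ShellMeasureAverageProp4General (O1cov C2cov)
open ShellMeasureLandauCorrectionB7 (landauCf landauRad)
open ShellMeasureLandauCorrectionReal (skewPi)
open ShellMeasureLandauCfBoxLocal (landauCfBox)
open ShellMeasureRootCompositionHistories (histLaw partialLaw histWeight histShell)
open ShellMeasureHistoriesTransport (hac_histories_of_layers)
open ShellMeasureThresholdUnitsHistories (shellWeightBound_histories_age_of_localRate)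
open ShellMeasureLiveEndOneCallSlotHistories (hac_live_of_assembled_decay_histories_cfB7)
open scoped Matrix.Norms.L2Operator

variable {σ ι : Type*} [DecidableEq σ] {n : Type*} [Fintype n] [DecidableEq n] [Nonempty n]

/-- **`ShellWeightBound` ON THE HISTORIES ROAD ⇐ THE NAMED BINDERS** (row S103b; module docstring).  CONDITIONAL on every displayed binder; nothing
PRINTED is asserted; NOT Bałaban's minimiser; `LocalRate` by name; NE7c NOT proved. [folklore] -/
theorem shellWeightBound_histories_oneCall_cfB7
    -- THE HISTORIES STRUCTURE of the comparison (S24∕S90 f3): common sample spaces `Ω K`, term families `T K`, slots `C K`, live-small slots per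
    -- history `small K τ ⊆ C K`, slot levels `lvl K s`; per run `r` the history laws `ν r K t τ` (finite) and END-I's tested variables `v r K t s`
    {Ω : ℕ → Type*} [∀ K, MeasurableSpace (Ω K)] {T : ℕ → Finset ι} {C : ℕ → Finset σ} {small : ℕ → ι → Finset σ} {lvl : ℕ → σ → ℕ}
    {ν : Bool → ∀ K : ℕ, ℝ → ι → Measure (Ω K)} [∀ r K t τ, IsFiniteMeasure (ν r K t τ)] {v : Bool → ∀ K : ℕ, ℝ → σ → Ω K → ℝ}
    (hv : ∀ r K t s, Measurable (v r K t s)) (hsmall : ∀ K, ∀ τ ∈ T K, small K τ ⊆ C K) {l₀ : ℝ}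
    -- THE SLOT LAYERS per run: lattice `(P r K s, jl r K s)`; END-II's profiles `η β` by lattice level, the age threshold `ε`, level constants `D r`
    (P : Bool → ℕ → σ → Params) (jl : Bool → ℕ → σ → ℕ) [∀ r K s, DecidableEq (PBond (P r K s) (jl r K s))]
    {ε : ℕ → ℝ} {η β D : Bool → ℕ → ℝ} (hη : ∀ r j, 0 < η r j) (hε : ∀ a, 0 < ε a) (hD0 : ∀ r j, 0 ≤ D r j)
    -- node U1b BY NAME (S90 f3's binders VERBATIM): the local rate, the floor on the age profile, the realisation identities, `D ≤ D̄`, the window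
    {Dat Sit : Type*} {R : Readings Dat Sit} {Cr ϑ θmin : ℝ} {N₁ : ℕ} {νbar Dbar : ℝ}
    (hloc : LocalRate R Cr ϑ) (hCr : 0 ≤ Cr) (hϑ0 : 0 < ϑ) (hϑ1 : ϑ < 1) (hmin : 0 < θmin) (hfloorN : ∀ a ≤ N₁, θmin ≤ ε a)
    (hRA : ∀ K t, |t| ≤ l₀ → ∀ τ ∈ T K, ∀ s ∈ small K τ, ∀ᵐ ω ∂(ν true K t τ), ∃ V ∈ R.dom, ∃ x : Sit,
      v true K t s ω = R.loc (lvl K s) V x ∧ v false K t s ω = R.loc (lvl K s + 1) V x)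
    (hRB : ∀ K t, |t| ≤ l₀ → ∀ τ ∈ T K, ∀ s ∈ small K τ, ∀ᵐ ω ∂(ν false K t τ), ∃ V ∈ R.dom, ∃ x : Sit,
      v true K t s ω = R.loc (lvl K s) V x ∧ v false K t s ω = R.loc (lvl K s + 1) V x)
    (hw : LiveWindow C lvl N₁ νbar) (hDbar : ∀ r j, D r j ≤ Dbar)
    -- THE LAYER READING (S103a; [dict] node O — at one averaging step KERNEL under `HaarAC`, S103a §4): measurable maps to the slot's layer, END-I's
    -- variable = END-II's normalised classifier read through them, each history's law pushed to the layer = the KEPT layer measure `𝟙{u∕η² < ε}·F … τ`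
    (π : ∀ r K s, Ω K → GaugeField (P r K s) (jl r K s) SU2) (hπ : ∀ r K s, Measurable (π r K s))
    -- ══ EVERY END-II binder of S99 f3b as a family: types∕box∕chart by `(r,K,s)`, the classifier side by `(r,K,t,s)`, the DENSITY side by
    -- `(r,K,t,s,τ)` (history-indexed), `κr κc κwb κcb dbar Kw` by lattice level — file 1‴'s list with END-I's `lvl K s`, `ε (K − lvl K s)` ══
    {𝒴 𝒵 ℬ : Bool → ℕ → σ → Type*} [∀ r K s, NormedAddCommGroup (𝒴 r K s)] [∀ r K s, NormedSpace ℂ (𝒴 r K s)] [∀ r K s, CompleteSpace (𝒴 r K s)]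
    [∀ r K s, NormedAddCommGroup (𝒵 r K s)] [∀ r K s, NormedSpace ℂ (𝒵 r K s)] [∀ r K s, NormedAddCommGroup (ℬ r K s)]
    [∀ r K s, NormedSpace ℂ (ℬ r K s)] {𝔸 : Bool → ℕ → σ → Type*} [∀ r K s, CStarAlgebra (𝔸 r K s)] [∀ r K s, Nontrivial (𝔸 r K s)]
    {lo hi : ∀ r K s, Fin (P r K s).d → ℤ} {nb : Bool → ℕ → σ → ℕ} (hn : ∀ r K s, ∀ κ, hi r K s κ ≤ lo r K s κ + nb r K s)
    (hN : ∀ r K s, ∀ κ, hi r K s κ - lo r K s κ < (P r K s).sitesPerDir (jl r K s)) (Λ : ∀ r K s, Finset (PBond (P r K s) (jl r K s)))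
    (hΛbox : ∀ r K s, ∀ b ∈ Λ r K s, b ∈ boxBonds (lo r K s) (hi r K s)) (hΛcomb : ∀ r K s, Disjoint (Λ r K s) (combBonds (lo r K s) (hi r K s)))
    {m₀ : Bool → ℕ → σ → ℕ} (e : ∀ r K s, ↥(Λ r K s) × Fin 3 ≃ Fin (m₀ r K s)) {S : ℝ} (hS : 0 < S) (hSπ : 3 * S ^ 2 < Real.pi ^ 2)
    {F : ∀ r K (t : ℝ) s (τ : ι), GaugeField (P r K s) (jl r K s) SU2 → ℝ≥0∞} (hF : ∀ r K t s τ, Measurable (F r K t s τ))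
    (hFi : ∀ r K t s τ, GaugeInvariant (F r K t s τ)) {u : ∀ r K (t : ℝ) s, GaugeField (P r K s) (jl r K s) SU2 → ℝ}
    (hu : ∀ r K t s, Measurable (u r K t s)) (hui : ∀ r K t s, GaugeInvariant (u r K t s)) {ιc : Bool → ℕ → σ → Type*}
    {Pu : ∀ r K (t : ℝ) s, Finset (ιc r K s)} (hPu : ∀ r K t s, (Pu r K t s).Nonempty)
    (W : ∀ r K (t : ℝ) s (τ : ι), GaugeField (P r K s) (jl r K s) SU2 → Set (Fin (m₀ r K s) → ℝ))
    (Jco : ∀ r K (t : ℝ) s (τ : ι), GaugeField (P r K s) (jl r K s) SU2 → (Fin (m₀ r K s) → ℝ) → ℝ≥0∞) {δ : ℝ}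
    (𝒢 : ∀ r K (t : ℝ) s, GaugeField (P r K s) (jl r K s) SU2 → (𝒵 r K s →L[ℂ] (𝒴 r K s)))
    (W𝒱 : ∀ r K (t : ℝ) s, GaugeField (P r K s) (jl r K s) SU2 → 𝒴 r K s → 𝒵 r K s) {B₀ C₄ a₃ ε₄ : ℝ}
    (h𝒢 : ∀ r K t s, ∀ V f, ‖𝒢 r K t s V f‖ ≤ B₀ * ‖f‖) (hW : ∀ r K t s, ∀ V, Prop4Hyp (W𝒱 r K t s V) C₄ a₃) (hB₀ : 0 < B₀) (hC₄ : 0 ≤ C₄)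
    (hε₄ : 0 ≤ ε₄) {dL C₁ B₃ ε₁ : ℝ} (hdL : 0 ≤ dL) (hC₁ : 0 ≤ C₁) (hε₁ : 0 ≤ ε₁) (hB₃ : dL ≤ B₃) (h1 : 2 * B₀ * C₁ * B₃ * ε₁ ≤ ε₄) (h2 : 4 * ε₄ ≤ a₃)
    (h3 : 16 * B₀ * C₄ * ε₄ ≤ 1) (H₁ : ∀ r K (t : ℝ) s, GaugeField (P r K s) (jl r K s) SU2 → (ℬ r K s →L[ℂ] (𝒴 r K s)))
    (hH₁ : ∀ r K t s, ∀ V B, ‖H₁ r K t s V B‖ ≤ B₀ * ‖B‖) (Φ : ∀ r K (t : ℝ) s, GaugeField (P r K s) (jl r K s) SU2 → (Fin (m₀ r K s) → ℂ) → ℬ r K s)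
    {rΦ : ℝ} (hΦd : ∀ r K t s, ∀ V, DifferentiableOn ℂ (Φ r K t s V) (ball 0 rΦ)) (hΦ0 : ∀ r K t s, ∀ V, Φ r K t s V 0 = 0)
    (hΦ : ∀ r K t s, ∀ V, ∀ z ∈ ball (0 : Fin (m₀ r K s) → ℂ) rΦ, ‖Φ r K t s V z‖ < 2 * dL * C₁ * ε₁) (hSr : S < rΦ) (k : Bool → ℕ → σ → ℕ)
    (Sf Sf' Sw Sw' Se Se' : ∀ r K s, Finset (B7Prop1Explicit.Site (P r K s).d × Fin (P r K s).d))
    (Ubg : ∀ r K (t : ℝ) s (τ : ι), GaugeField (P r K s) (jl r K s) SU2 → B7Prop1Explicit.Site (P r K s).d → Fin (P r K s).d → (𝔸 r K s)ˣ)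
    (hUbg : ∀ r K t s τ, ∀ V x κ, Ubg r K t s τ V x κ ∈ unitaryUnits (𝔸 r K s)) {α₀ : ℝ} (hα : 0 < α₀) (hα3 : ∀ r K s, C0 (P r K s).d * α₀ ≤ 1 / 3)
    (hα4 : ∀ r K s, 4 * α₀ ≤ c2' (P r K s).d (P r K s).L) (hα6 : ∀ r K s, 4 * O1cov (P r K s).d * α₀ ≤ 1 / 3)
    (h52locw : ∀ r K t s τ, ∀ V (c : ↥(Sw' r K s)), pdevOn (loK (P r K s).L (k r K s) c.1.1) (bondHiK (P r K s).L (k r K s) c.1.1 c.1.2) (Ubg r K t s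
      τ V) < α₀ * ((((P r K s).L : ℝ) ^ k r K s)⁻¹) ^ 2)
    (h52loce : ∀ r K t s τ, ∀ V (c : ↥(Se' r K s)), pdevOn (loK (P r K s).L (k r K s) c.1.1) (bondHiK (P r K s).L (k r K s) c.1.1 c.1.2) (Ubg r K t s
      τ V) < α₀ * ((((P r K s).L : ℝ) ^ k r K s)⁻¹) ^ 2)
    (ϖe₁ : ∀ r K (t : ℝ) s (τ : ι), ↥(Se r K s) → ℝ) (ϖe₂ : ∀ r K (t : ℝ) s (τ : ι), ↥(Se' r K s) → ℝ) (hϖe₁ : ∀ r K t s τ, ∀ b, 0 ≤ ϖe₁ r K t s τ b)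
    (hϖe₂ : ∀ r K t s τ, ∀ c, 0 ≤ ϖe₂ r K t s τ c) {r₀e : ℝ}
    (hreache : ∀ r K t s τ, ∀ (c : ↥(Se' r K s)) (b : ↥(Se r K s)), BondIn (loK (P r K s).L (k r K s) c.1.1) (bondHiK (P r K s).L (k r K s) c.1.1
      c.1.2) b.1.1 b.1.2 → ϖe₂ r K t s τ c - r₀e ≤ ϖe₁ r K t s τ b)
    (ιs : ∀ r K (t : ℝ) s, GaugeField (P r K s) (jl r K s) SU2 → (𝒴 r K s →L[ℂ] (↥(Sf r K s) → 𝔸 r K s)))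
    (hι : ∀ r K t s, ∀ V Y, ‖ιs r K t s V Y‖ ≤ ‖Y‖)
    (Hop : ∀ r K (t : ℝ) s, GaugeField (P r K s) (jl r K s) SU2 → ((↥(Sf' r K s) → 𝔸 r K s) →L[ℂ] (𝒴 r K s)))
    (hH : ∀ r K t s, ∀ V X, ‖Hop r K t s V X‖ ≤ B₀ * ‖X‖) {ε₃ : ℝ} (h18 : ∀ r K s, 18 * C2cov (P r K s).d * B₀ * ε₃ ≤ 1)
    (hcoup : ε₄ + B₀ * (2 * dL * C₁ * ε₁) ≤ ε₃) (h3R : ∀ r K s, 3 * ε₃ ≤ landauRad (P r K s).d (P r K s).L)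
    (ℓs : ∀ r K (t : ℝ) s, ιc r K s → List (𝒴 r K s →L[ℂ] Matrix n n ℂ)) {κr : Bool → ℕ → ℝ} (hκ : ∀ r K s, 0 ≤ κr r (jl r K s))
    (hℓ : ∀ r K t s, ∀ p ∈ Pu r K t s, ∀ ℓ ∈ ℓs r K t s p, ∀ Y, ‖ℓ Y‖ ≤ κr r (jl r K s) * ‖Y‖) {m : ℕ}
    (hlen : ∀ r K t s, ∀ p ∈ Pu r K t s, (ℓs r K t s p).length ≤ m) {κc : Bool → ℕ → ℝ} (hκc : ∀ r K s, 0 ≤ κc r (jl r K s))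
    (hcurl : ∀ r K t s, ∀ p ∈ Pu r K t s, ∀ Y, ‖((ℓs r K t s p).map fun ℓ => ℓ Y).sum‖ ≤ κc r (jl r K s) * ‖Y‖) {Λw Λz Λb 𝔖 : Bool → ℕ → σ → Type*}
    [∀ r K s, Fintype (Λw r K s)] [∀ r K s, DecidableEq (Λw r K s)] [∀ r K s, Fintype (Λz r K s)] [∀ r K s, Fintype (Λb r K s)]
    {𝔄w ℭ 𝔇 : Bool → ℕ → σ → Type*} [∀ r K s, NormedAddCommGroup (𝔄w r K s)] [∀ r K s, NormedSpace ℂ (𝔄w r K s)] [∀ r K s, CompleteSpace (𝔄w r K s)]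
    [∀ r K s, NormedAddCommGroup (ℭ r K s)] [∀ r K s, NormedSpace ℂ (ℭ r K s)] [∀ r K s, NormedAddCommGroup (𝔇 r K s)]
    [∀ r K s, NormedSpace ℂ (𝔇 r K s)] {δw : ℝ} (hδw : 0 ≤ δw) (ϖw : ∀ r K (t : ℝ) s (τ : ι), 𝔖 r K s → ℝ)
    (dis : ∀ r K (t : ℝ) s (τ : ι), 𝔖 r K s → 𝔖 r K s → ℝ) (hϖw : ∀ r K t s τ, ∀ x y, ϖw r K t s τ x ≤ ϖw r K t s τ y + dis r K t s τ x y)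
    (pos : ∀ r K (t : ℝ) s (τ : ι), Λw r K s → 𝔖 r K s) (posz : ∀ r K (t : ℝ) s (τ : ι), Λz r K s → 𝔖 r K s)
    (pos' : ∀ r K (t : ℝ) s (τ : ι), ↥(Sw r K s) → 𝔖 r K s) (posx : ∀ r K (t : ℝ) s (τ : ι), ↥(Sw' r K s) → 𝔖 r K s)
    (posb : ∀ r K (t : ℝ) s (τ : ι), Λb r K s → 𝔖 r K s)
    (k𝒢 : ∀ r K (t : ℝ) s (τ : ι), GaugeField (P r K s) (jl r K s) SU2 → Λw r K s → Λz r K s → (ℭ r K s →L[ℂ] (𝔄w r K s)))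
    (kι : ∀ r K (t : ℝ) s (τ : ι), GaugeField (P r K s) (jl r K s) SU2 → ↥(Sw r K s) → Λw r K s → (𝔄w r K s →L[ℂ] (𝔸 r K s)))
    (kH : ∀ r K (t : ℝ) s (τ : ι), GaugeField (P r K s) (jl r K s) SU2 → Λw r K s → ↥(Sw' r K s) → (𝔸 r K s →L[ℂ] (𝔄w r K s)))
    (kH₁ : ∀ r K (t : ℝ) s (τ : ι), GaugeField (P r K s) (jl r K s) SU2 → Λw r K s → Λb r K s → (𝔇 r K s →L[ℂ] (𝔄w r K s)))
    {c𝒢 δ𝒢 M𝒢 cι δι Mι cH δH MH cH₁ δH₁ MH₁ : ℝ} (hc𝒢 : 0 ≤ c𝒢) (hM𝒢 : 0 ≤ M𝒢)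
    (hk𝒢 : ∀ r K t s τ, ∀ V c b', ‖k𝒢 r K t s τ V c b'‖ ≤ c𝒢 * Real.exp (-(δ𝒢 * dis r K t s τ (pos r K t s τ c) (posz r K t s τ b'))))
    (hM𝒢' : ∀ r K t s τ, ∀ x, ∑ b', Real.exp (-((δ𝒢 - δw) * dis r K t s τ x (posz r K t s τ b'))) ≤ M𝒢) (hcι : 0 ≤ cι) (hMι : 0 ≤ Mι)
    (hkι : ∀ r K t s τ, ∀ V c b', ‖kι r K t s τ V c b'‖ ≤ cι * Real.exp (-(δι * dis r K t s τ (pos' r K t s τ c) (pos r K t s τ b'))))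
    (hMι' : ∀ r K t s τ, ∀ x, ∑ b', Real.exp (-((δι - δw) * dis r K t s τ x (pos r K t s τ b'))) ≤ Mι) (hcH : 0 ≤ cH) (hMH : 0 ≤ MH)
    (hkH : ∀ r K t s τ, ∀ V c b', ‖kH r K t s τ V c b'‖ ≤ cH * Real.exp (-(δH * dis r K t s τ (pos r K t s τ c) (posx r K t s τ b'))))
    (hMH' : ∀ r K t s τ, ∀ x, ∑ b', Real.exp (-((δH - δw) * dis r K t s τ x (posx r K t s τ b'))) ≤ MH) (hcH₁ : 0 ≤ cH₁) (hMH₁ : 0 ≤ MH₁)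
    (hkH₁ : ∀ r K t s τ, ∀ V c b', ‖kH₁ r K t s τ V c b'‖ ≤ cH₁ * Real.exp (-(δH₁ * dis r K t s τ (pos r K t s τ c) (posb r K t s τ b'))))
    (hMH₁' : ∀ r K t s τ, ∀ x, ∑ b', Real.exp (-((δH₁ - δw) * dis r K t s τ x (posb r K t s τ b'))) ≤ MH₁)
    (W𝒱w : ∀ r K (t : ℝ) s (τ : ι), GaugeField (P r K s) (jl r K s) SU2 → (Λw r K s → 𝔄w r K s) → (Λz r K s → ℭ r K s)) {B₀w C₄w a₃w ε₄w bw : ℝ}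
    (h𝒢w : ∀ r K t s τ, ∀ V f, ‖kerOp (k𝒢 r K t s τ V) f‖ ≤ B₀w * ‖f‖) (hWw : ∀ r K t s τ, ∀ V, Prop4Hyp (W𝒱w r K t s τ V) C₄w a₃w) (hB₀w : 0 < B₀w)
    (hC₄w : 0 ≤ C₄w) (hε₄w : 0 ≤ ε₄w) (hdomw : 2 * (ε₄w + B₀w * bw) ≤ a₃w) (hselfw : B₀w * C₄w * (ε₄w + B₀w * bw) ^ 2 ≤ ε₄w)
    (hcontrw : 4 * B₀w * C₄w * (ε₄w + B₀w * bw) < 1) (hH₁w : ∀ r K t s τ, ∀ V B, ‖kerOp (kH₁ r K t s τ V) B‖ ≤ B₀w * ‖B‖)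
    (Φw : ∀ r K (t : ℝ) s (τ : ι), GaugeField (P r K s) (jl r K s) SU2 → (Fin (m₀ r K s) → ℂ) → (Λb r K s → 𝔇 r K s)) {rΦw : ℝ}
    (hΦdw : ∀ r K t s τ, ∀ V, DifferentiableOn ℂ (Φw r K t s τ V) (ball 0 rΦw)) (hΦ0w : ∀ r K t s τ, ∀ V, Φw r K t s τ V 0 = 0)
    (hΦbw : ∀ r K t s τ, ∀ V, ∀ z ∈ ball (0 : Fin (m₀ r K s) → ℂ) rΦw, ‖Φw r K t s τ V z‖ < bw) (h2Sw : 2 * S ≤ rΦw)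
    (hιw : ∀ r K t s τ, ∀ V Y, ‖kerOp (kι r K t s τ V) Y‖ ≤ ‖Y‖) (hHw : ∀ r K t s τ, ∀ V X, ‖kerOp (kH r K t s τ V) X‖ ≤ B₀w * ‖X‖)
    (hqw : ∀ r K s, 9 * C2cov (P r K s).d * B₀w * (ε₄w + B₀w * bw) < 1) (hRCw : ∀ r K s, 6 * (ε₄w + B₀w * bw) ≤ landauRad (P r K s).d (P r K s).L)
    (NW : ∀ r K (t : ℝ) s (τ : ι), Λz r K s → Λw r K s → Prop)
    (hlocW : ∀ r K t s τ, ∀ V, ∀ A A' : Λw r K s → 𝔄w r K s, ∀ c', (∀ b', NW r K t s τ c' b' → A b' = A' b') → W𝒱w r K t s τ V A c' = W𝒱w r K t s τ V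
      A' c')
    {rW : ℝ} (hreachW : ∀ r K t s τ, ∀ c' b', NW r K t s τ c' b' → ϖw r K t s τ (posz r K t s τ c') - rW ≤ ϖw r K t s τ (pos r K t s τ b')) {rC : ℝ}
    (hreachC : ∀ r K t s τ, ∀ (c' : ↥(Sw' r K s)) (b' : ↥(Sw r K s)), BondIn (loK (P r K s).L (k r K s) c'.1.1) (bondHiK (P r K s).L (k r K s) c'.1.1
      c'.1.2) b'.1.1 b'.1.2 → ϖw r K t s τ (posx r K t s τ c') - rC ≤ ϖw r K t s τ (pos' r K t s τ b'))
    (hsupp : ∀ r K t s τ, ∀ V, ∀ z : Fin (m₀ r K s) → ℂ, ∀ i, 0 < ϖw r K t s τ (posb r K t s τ i) → Φw r K t s τ V z i = 0)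
    (hqW : c𝒢 * M𝒢 * (2 * C₄w * a₃w * Real.exp (δw * rW)) < 1)
    (hk : ∀ r K s, 2 * C2cov (P r K s).d * landauRad (P r K s).d (P r K s).L * Real.exp (δw * rC) * (cι * Mι) * (cH * MH) < 1)
    {𝔭 : Bool → ℕ → σ → Type*} (Pw : ∀ r K (t : ℝ) s (τ : ι), Finset (𝔭 r K s))
    (ℓw : ∀ r K (t : ℝ) s (τ : ι), 𝔭 r K s → List ((Λw r K s → 𝔄w r K s) →L[ℂ] Matrix n n ℂ))
    (suppw : ∀ r K (t : ℝ) s (τ : ι), 𝔭 r K s → Finset (Λw r K s)) (ϖPw : ∀ r K (t : ℝ) s (τ : ι), 𝔭 r K s → ℝ)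
    (hblindw : ∀ r K t s τ, ∀ p ∈ Pw r K t s τ, ∀ ℓ ∈ ℓw r K t s τ p, ∀ A A' : Λw r K s → 𝔄w r K s, (∀ b' ∈ suppw r K t s τ p, A b' = A' b') → ℓ A = ℓ
      A')
    (hdepthw : ∀ r K t s τ, ∀ p ∈ Pw r K t s τ, ∀ b' ∈ suppw r K t s τ p, ϖPw r K t s τ p ≤ ϖw r K t s τ (pos r K t s τ b'))
    (hϖPw : ∀ r K t s τ, ∀ p ∈ Pw r K t s τ, 0 ≤ ϖPw r K t s τ p) {κwb κcb : Bool → ℕ → ℝ} (hκwb : ∀ r K s, 0 ≤ κwb r (jl r K s))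
    (hκcb : ∀ r K s, 0 ≤ κcb r (jl r K s)) (hℓwb : ∀ r K t s τ, ∀ p ∈ Pw r K t s τ, ∀ ℓ ∈ ℓw r K t s τ p, ‖ℓ‖ ≤ κwb r (jl r K s))
    (hcurlw : ∀ r K t s τ, ∀ p ∈ Pw r K t s τ, ‖(ℓw r K t s τ p).sum‖ ≤ κcb r (jl r K s)) {mw : ℕ}
    (hlenw : ∀ r K t s τ, ∀ p ∈ Pw r K t s τ, (ℓw r K t s τ p).length ≤ mw) (𝓡𝒴w : ∀ r K (t : ℝ) s (τ : ι), AddSubgroup (Λw r K s → 𝔄w r K s))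
    (h𝓡𝒴w : ∀ r K t s τ, IsClosed (𝓡𝒴w r K t s τ : Set (Λw r K s → 𝔄w r K s))) (𝓡𝒵w : ∀ r K (t : ℝ) s (τ : ι), AddSubgroup (Λz r K s → ℭ r K s))
    (𝓡ℬw : ∀ r K (t : ℝ) s (τ : ι), AddSubgroup (Λb r K s → 𝔇 r K s))
    (h𝒢rw : ∀ r K t s τ, ∀ V, ∀ f ∈ 𝓡𝒵w r K t s τ, kerOp (k𝒢 r K t s τ V) f ∈ 𝓡𝒴w r K t s τ)
    (hWrw : ∀ r K t s τ, ∀ V, ∀ Y ∈ 𝓡𝒴w r K t s τ, W𝒱w r K t s τ V Y ∈ 𝓡𝒵w r K t s τ)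
    (hιrw : ∀ r K t s τ, ∀ V, ∀ Y ∈ 𝓡𝒴w r K t s τ, kerOp (kι r K t s τ V) Y ∈ skewPi ↥(Sw r K s))
    (hHrw : ∀ r K t s τ, ∀ V, ∀ X ∈ skewPi (𝔸 := 𝔸 r K s) ↥(Sw' r K s), kerOp (kH r K t s τ V) X ∈ 𝓡𝒴w r K t s τ)
    (hH₁rw : ∀ r K t s τ, ∀ V, ∀ B ∈ 𝓡ℬw r K t s τ, kerOp (kH₁ r K t s τ V) B ∈ 𝓡𝒴w r K t s τ)
    (hΦrw : ∀ r K t s τ, ∀ V, ∀ y : Fin (m₀ r K s) → ℝ, ‖y‖ ≤ S → Φw r K t s τ V (cplx y) ∈ 𝓡ℬw r K t s τ)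
    (hskew : ∀ r K t s τ, ∀ p ∈ Pw r K t s τ, ∀ ℓ ∈ ℓw r K t s τ p, ∀ Y ∈ 𝓡𝒴w r K t s τ, ℓ Y ∈ skewAdjoint (Matrix n n ℂ))
    (Bp : ∀ r K (t : ℝ) s (τ : ι), GaugeField (P r K s) (jl r K s) SU2 → 𝔭 r K s → Matrix n n ℂ) {d : ∀ r K (t : ℝ) s (τ : ι), 𝔭 r K s → ℝ}
    {dbar : Bool → ℕ → ℝ} (hBu : ∀ r K t s τ, ∀ V, ∀ p ∈ Pw r K t s τ, Bp r K t s τ V p ∈ unitary (Matrix n n ℂ))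
    (hBd : ∀ r K t s τ, ∀ V, ∀ p ∈ Pw r K t s τ, ‖Bp r K t s τ V p - 1‖ ≤ d r K t s τ p)
    (hd : ∀ r K t s τ, ∀ p ∈ Pw r K t s τ, d r K t s τ p ≤ dbar r (jl r K s)) (hdbar : ∀ r K s, 0 ≤ dbar r (jl r K s)) {Kw : Bool → ℕ → ℝ}
    (hKw : ∀ r K t s τ, ∑ p ∈ Pw r K t s τ, Real.exp (-(δw * ϖPw r K t s τ p)) ≤ Kw r (jl r K s)) {Λe : Bool → ℕ → σ → Type*}
    [∀ r K s, Fintype (Λe r K s)] {𝔄 : Bool → ℕ → σ → Type*} [∀ r K s, NormedAddCommGroup (𝔄 r K s)] [∀ r K s, NormedSpace ℂ (𝔄 r K s)]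
    [∀ r K s, CompleteSpace (𝔄 r K s)] {δ' : ℝ} {ϖ : ∀ r K (t : ℝ) s (τ : ι), Λe r K s → ℝ} (hδ' : 0 ≤ δ')
    (hϖ : ∀ r K t s τ, ∀ b', 0 ≤ ϖ r K t s τ b') {𝒵e ℬe : Bool → ℕ → σ → Type*} [∀ r K s, NormedAddCommGroup (𝒵e r K s)]
    [∀ r K s, NormedSpace ℂ (𝒵e r K s)] [∀ r K s, NormedAddCommGroup (ℬe r K s)] [∀ r K s, NormedSpace ℂ (ℬe r K s)]
    (𝒢e : ∀ r K t s (τ : ι), GaugeField (P r K s) (jl r K s) SU2 → (𝒵e r K s →L[ℂ] WSup (pinW δ' (ϖ r K t s τ)) 1 (𝔄 r K s)))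
    (W𝒱e : ∀ r K t s (τ : ι), GaugeField (P r K s) (jl r K s) SU2 → WSup (pinW δ' (ϖ r K t s τ)) 1 (𝔄 r K s) → 𝒵e r K s) {B₀e C₄e a₃e be ε₄e : ℝ}
    (h𝒢e : ∀ r K t s τ, ∀ V f, ‖𝒢e r K t s τ V f‖ ≤ B₀e * ‖f‖) (hWe : ∀ r K t s τ, ∀ V, Prop4Hyp (W𝒱e r K t s τ V) C₄e a₃e) (hB₀e : 0 < B₀e)
    (hC₄e : 0 ≤ C₄e) (hbe : 0 ≤ be) (hε₄e : 0 ≤ ε₄e) (hdome : 2 * (ε₄e + B₀e * be) ≤ a₃e) (hselfe : B₀e * C₄e * (ε₄e + B₀e * be) ^ 2 ≤ ε₄e)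
    (hcontre : 4 * B₀e * C₄e * (ε₄e + B₀e * be) < 1)
    (H₁e : ∀ r K t s (τ : ι), GaugeField (P r K s) (jl r K s) SU2 → (ℬe r K s →L[ℂ] WSup (pinW δ' (ϖ r K t s τ)) 1 (𝔄 r K s)))
    (hH₁e : ∀ r K t s τ, ∀ V B, ‖H₁e r K t s τ V B‖ ≤ B₀e * ‖B‖)
    (Φe : ∀ r K (t : ℝ) s (τ : ι), GaugeField (P r K s) (jl r K s) SU2 → (Fin (m₀ r K s) → ℂ) → ℬe r K s) {rΦe : ℝ}
    (hΦde : ∀ r K t s τ, ∀ V, DifferentiableOn ℂ (Φe r K t s τ V) (ball 0 rΦe)) (hΦ0e : ∀ r K t s τ, ∀ V, Φe r K t s τ V 0 = 0)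
    (hΦbe : ∀ r K t s τ, ∀ V, ∀ z ∈ ball (0 : Fin (m₀ r K s) → ℂ) rΦe, ‖Φe r K t s τ V z‖ < be) (hSre : S < rΦe)
    (ιe : ∀ r K t s (τ : ι), GaugeField (P r K s) (jl r K s) SU2 → (WSup (pinW δ' (ϖ r K t s τ)) 1 (𝔄 r K s) →L[ℂ] WSup (pinW δ' (ϖe₁ r K t s τ)) 1 (𝔸
      r K s)))
    (hιe : ∀ r K t s τ, ∀ V Y, ‖ιe r K t s τ V Y‖ ≤ ‖Y‖)
    (He : ∀ r K t s (τ : ι), GaugeField (P r K s) (jl r K s) SU2 → (WSup (pinW δ' (ϖe₂ r K t s τ)) 1 (𝔸 r K s) →L[ℂ] WSup (pinW δ' (ϖ r K t s τ)) 1 (𝔄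
      r K s)))
    (hHe : ∀ r K t s τ, ∀ V X, ‖He r K t s τ V X‖ ≤ B₀e * ‖X‖)
    (hqe : ∀ r K s, 9 * (C2cov (P r K s).d * Real.exp (2 * δ' * r₀e)) * B₀e * (ε₄e + B₀e * be) < 1)
    (hRCe : ∀ r K s, 3 * (ε₄e + B₀e * be) ≤ landauRad (P r K s).d (P r K s).L) {𝔱 : Bool → ℕ → σ → Type*}
    (I : ∀ r K (t : ℝ) s (τ : ι), Finset (𝔱 r K s)) {Ef : ∀ r K (t : ℝ) s (τ : ι), 𝔱 r K s → (Λe r K s → 𝔄 r K s) → ℂ} {rE : ℝ}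
    {ee : ∀ r K (t : ℝ) s (τ : ι), 𝔱 r K s → ℝ} (hrE : 0 < rE) (hEd : ∀ r K t s τ, ∀ i ∈ I r K t s τ, DifferentiableOn ℂ (Ef r K t s τ i) (ball 0 rE))
    (hEb : ∀ r K t s τ, ∀ i ∈ I r K t s τ, ∀ Z ∈ ball (0 : Λe r K s → 𝔄 r K s) rE, ‖Ef r K t s τ i Z‖ ≤ ee r K t s τ i)
    (he0 : ∀ r K t s τ, ∀ i ∈ I r K t s τ, 0 ≤ ee r K t s τ i) (supp : ∀ r K (t : ℝ) s (τ : ι), 𝔱 r K s → Finset (Λe r K s))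
    (hblind : ∀ r K t s τ, ∀ i ∈ I r K t s τ, ∀ A₁ A₂ : Λe r K s → 𝔄 r K s, (∀ b' ∈ supp r K t s τ i, A₁ b' = A₂ b') → Ef r K t s τ i A₁ = Ef r K t s
      τ i A₂)
    (ϖP : ∀ r K (t : ℝ) s (τ : ι), 𝔱 r K s → ℝ) (hdepth : ∀ r K t s τ, ∀ i ∈ I r K t s τ, ∀ b' ∈ supp r K t s τ i, ϖP r K t s τ i ≤ ϖ r K t s τ b')
    {LK : ℝ} (hLK : 0 ≤ LK) (hK : ∀ r K t s τ, ∑ i ∈ I r K t s τ, 2 * ee r K t s τ i / rE * Real.exp (-(δ' * ϖP r K t s τ i)) ≤ LK)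
    (hcoupE : ∀ r K s, ((ε₄e + B₀e * be) + B₀e * (4 * (C2cov (P r K s).d * Real.exp (2 * δ' * r₀e)) * (ε₄e + B₀e * be) ^ 2)) ≤ rE / 2) {BE₁ : ℝ}
    (hElb₁ : ∀ r K t s τ, ∀ V (y : Fin (m₀ r K s) → ℝ), ‖y‖ ≤ S → -BE₁ ≤ (∑ i ∈ I r K t s τ, Ef r K t s τ i (WSup.toPiL (𝔄 := 𝔄 r K s) (pinW δ' (ϖ r K
      t s τ)) 1 (landauExp (fun Y : WSup (pinW δ' (ϖe₁ r K t s τ)) 1 (𝔸 r K s) => ((toPiL (pinW δ' (ϖe₂ r K t s τ)) 1).symm (landauCf (P r K s).L (Ubg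
      r K t s τ V) (k r K s) (Se r K s) (Se' r K s) (toPiL (pinW δ' (ϖe₁ r K t s τ)) 1 Y)) : WSup (pinW δ' (ϖe₂ r K t s τ)) 1 (𝔸 r K s))) (ιe r K t s
      τ V) (He r K t s τ V) (4 * (C2cov (P r K s).d * Real.exp (2 * δ' * r₀e)) * (ε₄e + B₀e * be) ^ 2) (solAt (𝒢e r K t s τ V) 0 (W𝒱e r K t s τ V) ε₄e
      (0 : 𝒵e r K s) (H₁e r K t s τ V (Φe r K t s τ V (cplx y))) + H₁e r K t s τ V (Φe r K t s τ V (cplx y)))))).re)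
    {Ω : Bool → ℕ → σ → Type*} [∀ r K s, MeasurableSpace (Ω r K s)] (μ : ∀ r K (t : ℝ) s (τ : ι), Measure (Ω r K s))
    {g : ∀ r K (t : ℝ) s (τ : ι), Ω r K s → ℝ} (hg : ∀ r K t s τ, ∀ ω, 0 ≤ g r K t s τ ω)
    (Aex : ∀ r K (t : ℝ) s (τ : ι), GaugeField (P r K s) (jl r K s) SU2 → (Fin (m₀ r K s) → ℝ) → Ω r K s → ℝ) {Bd : ℝ} (hBd0 : 0 ≤ Bd)
    (hint : ∀ r K t s τ, ∀ V, ∀ x ∈ W r K t s τ V, ∀ c : ℝ, 1 / 2 ≤ c → c ≤ 1 → Integrable (fun ω => g r K t s τ ω * Real.exp (Aex r K t s τ V (c • x)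
      ω)) (μ r K t s τ))
    (hpos : ∀ r K t s τ, ∀ V, ∀ x ∈ W r K t s τ V, ∀ c : ℝ, 1 / 2 ≤ c → c ≤ 1 → 0 < ∫ ω, g r K t s τ ω * Real.exp (Aex r K t s τ V (c • x) ω) ∂(μ r K
      t s τ))
    (hA : ∀ r K t s τ, ∀ V, ∀ x ∈ W r K t s τ V, ∀ c : ℝ, 1 / 2 ≤ c → c ≤ 1 → ∀ ω, Aex r K t s τ V x ω ≤ Aex r K t s τ V (c • x) ω + (1 - c) * Bd)
    {BE₂ : ℝ}
    (hElb₂ : ∀ r K t s τ, ∀ V (y : Fin (m₀ r K s) → ℝ), ‖y‖ ≤ S → -BE₂ ≤ (-Real.log (∫ ω, g r K t s τ ω * Real.exp (Aex r K t s τ V y ω) ∂(μ r K t s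
      τ))))
    (L : ∀ r K (t : ℝ) s, Set (𝒴 r K s →L[ℂ] Matrix n n ℂ)) (𝓡𝒵 : ∀ r K (t : ℝ) s, AddSubgroup (𝒵 r K s))
    (𝓡ℬ : ∀ r K (t : ℝ) s, AddSubgroup (ℬ r K s)) (h𝒢r : ∀ r K t s, ∀ V, ∀ f ∈ 𝓡𝒵 r K t s, 𝒢 r K t s V f ∈ readOutReal (L r K t s))
    (hWr : ∀ r K t s, ∀ V, ∀ Y ∈ readOutReal (L r K t s), W𝒱 r K t s V Y ∈ 𝓡𝒵 r K t s)
    (hιr : ∀ r K t s, ∀ V, ∀ Y ∈ readOutReal (L r K t s), ιs r K t s V Y ∈ skewPi ↥(Sf r K s))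
    (hHr : ∀ r K t s, ∀ V, ∀ X ∈ skewPi (𝔸 := 𝔸 r K s) ↥(Sf' r K s), Hop r K t s V X ∈ readOutReal (L r K t s))
    (hH₁r : ∀ r K t s, ∀ V, ∀ B ∈ 𝓡ℬ r K t s, H₁ r K t s V B ∈ readOutReal (L r K t s))
    (hΦr : ∀ r K t s, ∀ V, ∀ y : Fin (m₀ r K s) → ℝ, ‖y‖ ≤ S → Φ r K t s V (cplx y) ∈ 𝓡ℬ r K t s)
    (hRdict : ∀ r K t s τ, ∀ V, ∀ x ∈ cube (m₀ r K s) S, F r K t s τ (fixTo (combBonds (lo r K s) (hi r K s)) 1 (updateFinset V (Λ r K s)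
      (expFibreChart (Λ r K s) 1 (e r K s) x))) = Jco r K t s τ V x * ENNReal.ofReal (Real.exp (-((∑ p ∈ Pw r K t s τ, β r (jl r K s) * (1 -
      (Matrix.trace (Bp r K t s τ V p * holOf (ℓw r K t s τ p) (fun y => landauExp (landauCfBox (P r K s).L (Ubg r K t s τ V) (k r K s) (Sw r K s)
      (Sw' r K s) (landauRad (P r K s).d (P r K s).L)) (kerOp (kι r K t s τ V)) (kerOp (kH r K t s τ V)) (4 * C2cov (P r K s).d * (ε₄w + B₀w * bw) ^
      2) (solAt (kerOp (k𝒢 r K t s τ V)) 0 (W𝒱w r K t s τ V) ε₄w (0 : Λz r K s → ℭ r K s) (kerOp (kH₁ r K t s τ V) (Φw r K t s τ V (cplx y))) + kerOp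
      (kH₁ r K t s τ V) (Φw r K t s τ V (cplx y)))) x)).re / Fintype.card n)) + ((∑ i ∈ I r K t s τ, Ef r K t s τ i (WSup.toPiL (𝔄 := 𝔄 r K s) (pinW
      δ' (ϖ r K t s τ)) 1 (landauExp (fun Y : WSup (pinW δ' (ϖe₁ r K t s τ)) 1 (𝔸 r K s) => ((toPiL (pinW δ' (ϖe₂ r K t s τ)) 1).symm (landauCf (P r K
      s).L (Ubg r K t s τ V) (k r K s) (Se r K s) (Se' r K s) (toPiL (pinW δ' (ϖe₁ r K t s τ)) 1 Y)) : WSup (pinW δ' (ϖe₂ r K t s τ)) 1 (𝔸 r K s)))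
      (ιe r K t s τ V) (He r K t s τ V) (4 * (C2cov (P r K s).d * Real.exp (2 * δ' * r₀e)) * (ε₄e + B₀e * be) ^ 2) (solAt (𝒢e r K t s τ V) 0 (W𝒱e r K
      t s τ V) ε₄e (0 : 𝒵e r K s) (H₁e r K t s τ V (Φe r K t s τ V (cplx x))) + H₁e r K t s τ V (Φe r K t s τ V (cplx x)))))).re + (-Real.log (∫ ω, g
      r K t s τ ω * Real.exp (Aex r K t s τ V x ω) ∂(μ r K t s τ))))))))
    (hudict : ∀ r K t s, ∀ V, ∀ x ∈ cube (m₀ r K s) S, u r K t s (fixTo (combBonds (lo r K s) (hi r K s)) 1 (updateFinset V (Λ r K s) (expFibreChart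
      (Λ r K s) 1 (e r K s) x))) = classifier (hPu r K t s) (fun p => holOf (ℓs r K t s p) (fun y => landauExp ((ball (0 : ↥(Sf r K s) → 𝔸 r K s)
      (landauRad (P r K s).d (P r K s).L)).indicator (landauCf (P r K s).L (1 : B7Prop1Explicit.Site (P r K s).d → Fin (P r K s).d → (𝔸 r K s)ˣ) (k r
      K s) (Sf r K s) (Sf' r K s))) (ιs r K t s V) (Hop r K t s V) (4 * C2cov (P r K s).d * (ε₄ + B₀ * (2 * dL * C₁ * ε₁)) ^ 2) (solAt (𝒢 r K t s V) 0
      (W𝒱 r K t s V) ε₄ (0 : 𝒵 r K s) (H₁ r K t s V (Φ r K t s V (cplx y))) + H₁ r K t s V (Φ r K t s V (cplx y))))) x)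
    (hJW : ∀ r K t s τ, ∀ V x, Jco r K t s τ V x ≠ 0 → x ∈ W r K t s τ V)
    (hJ : ∀ r K t s τ, ∀ V x, ∀ a : ℝ, 0 ≤ a → Jco r K t s τ V x ≤ Jco r K t s τ V (Real.exp (-a) • x))
    (hJ1 : ∀ r K t s τ, ∀ V x, Jco r K t s τ V x ≤ 1) (hWS : ∀ r K t s τ, ∀ V, W r K t s τ V ⊆ closedBall (0 : Fin (m₀ r K s) → ℝ) S) (hδ0 : 0 ≤ δ)
    (hδ1 : δ < 1) {c₁ c₂ zs : ℝ}
    (hs₁ : ∀ r K s, κc r (jl r K s) * ((ε₄ + B₀ * (2 * dL * C₁ * ε₁)) + B₀ * (4 * C2cov (P r K s).d * (ε₄ + B₀ * (2 * dL * C₁ * ε₁)) ^ 2)) ≤ c₁ * η r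
      (jl r K s) ^ 2 * zs)
    (ha : ∀ r K s, κr r (jl r K s) * ((ε₄ + B₀ * (2 * dL * C₁ * ε₁)) + B₀ * (4 * C2cov (P r K s).d * (ε₄ + B₀ * (2 * dL * C₁ * ε₁)) ^ 2)) ≤ c₂ * η r
      (jl r K s) * zs)
    (hma : ∀ r K s, m * (κr r (jl r K s) * ((ε₄ + B₀ * (2 * dL * C₁ * ε₁)) + B₀ * (4 * C2cov (P r K s).d * (ε₄ + B₀ * (2 * dL * C₁ * ε₁)) ^ 2))) ≤ 1)
    (hsm : ∀ (K : ℕ) (s : σ), 36 * (c₁ * zs + m ^ 2 * c₂ ^ 2 * zs ^ 2) / (rΦ / S - 1) ^ 2 ≤ δ * ε (K - lvl K s)) {a : ℝ} (ha0 : 0 ≤ a)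
    (hrad : ∀ r K s, (((P r K s).d - 1 : ℕ) : ℝ) * nb r K s * a ≤ 2 * Real.sin (S / 2)) {Pcore : ∀ r K (t : ℝ) s, Set (Plaq (P r K s) (jl r K s))}
    {Pcollar : ∀ r K (t : ℝ) s (τ : ι), Set (Plaq (P r K s) (jl r K s))}
    (hcover : ∀ r K t s τ, boxPlaqs (lo r K s) (hi r K s) ⊆ Pcore r K t s ∪ (Pcollar r K t s τ))
    (hcore : ∀ r K t s, ∀ (V : GaugeField (P r K s) (jl r K s) SU2) (y : ↥(Λ r K s) → SU2), u r K t s (fixTo (combBonds (lo r K s) (hi r K s)) 1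
      (updateFinset V (Λ r K s) y)) < ε (K - lvl K s) * η r (jl r K s) ^ 2 → PlaqSmallOn (Pcore r K t s) a (fixTo (combBonds (lo r K s) (hi r K s)) 1
      (updateFinset V (Λ r K s) y)))
    (hcollar : ∀ r K t s τ, ∀ (V : GaugeField (P r K s) (jl r K s) SU2) (y : ↥(Λ r K s) → SU2), F r K t s τ (fixTo (combBonds (lo r K s) (hi r K s)) 1
      (updateFinset V (Λ r K s) y)) ≠ 0 → PlaqSmallOn (Pcollar r K t s τ) a (fixTo (combBonds (lo r K s) (hi r K s)) 1 (updateFinset V (Λ r K s) y)))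
    (hβ : ∀ r j, 0 ≤ β r j)
    -- END-II's width is END-I's `geomWidth` (S99 f3b's number rows `hρ0`∕`hρ` DISCHARGED ∕ DISPLAYED as ONE inequality)
    (hρg : ∀ j, geomWidth Cr θmin ϑ j ≤ (1 - δ) / 2)
    (hread : ∀ r K t, |t| ≤ l₀ → ∀ s ∈ C K, v r K t s = (fun U => u r K t s U / η r (jl r K s) ^ 2) ∘ π r K s)
    (hid : ∀ r K t, |t| ≤ l₀ → ∀ s ∈ C K, ∀ τ ∈ T K, s ∈ small K τ → (histLaw (ν r K t τ) (small K τ) (v r K t) (fun s' => ε (K - lvl K s'))).map (π r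
      K s) = (fieldMeasure (P r K s) (jl r K s) SU2).withDensity ({U | u r K t s U / η r (jl r K s) ^ 2 < ε (K - lvl K s)}.indicator (F r K t s τ)))
    -- the slot → level majorant: S99 f3b's slot constant under the run's level profile `D r`, on the live slots
    (hDslot : ∀ r K t, |t| ≤ l₀ → ∀ s ∈ C K, 2 * ((m₀ r K s : ℝ) + (3 * (|β r (jl r K s)| * ((dbar r (jl r K s) + 2 * (κcb r (jl r K s) * (cH₁ * MH₁ *
      bw / ((1 - c𝒢 * M𝒢 * (2 * C₄w * a₃w * Real.exp (δw * rW))) * (1 - 2 * C2cov (P r K s).d * landauRad (P r K s).d (P r K s).L * Real.exp (δw * rC)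
      * (cι * Mι) * (cH * MH)))) + expTail₂ (mw * (κwb r (jl r K s) * (cH₁ * MH₁ * bw / ((1 - c𝒢 * M𝒢 * (2 * C₄w * a₃w * Real.exp (δw * rW))) * (1 - 2
      * C2cov (P r K s).d * landauRad (P r K s).d (P r K s).L * Real.exp (δw * rC) * (cι * Mι) * (cH * MH))))))) / (rΦw / S)) * (2 * (κcb r (jl r K s)
      * (cH₁ * MH₁ * bw / ((1 - c𝒢 * M𝒢 * (2 * C₄w * a₃w * Real.exp (δw * rW))) * (1 - 2 * C2cov (P r K s).d * landauRad (P r K s).d (P r K s).L *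
      Real.exp (δw * rC) * (cι * Mι) * (cH * MH)))) + expTail₂ (mw * (κwb r (jl r K s) * (cH₁ * MH₁ * bw / ((1 - c𝒢 * M𝒢 * (2 * C₄w * a₃w * Real.exp
      (δw * rW))) * (1 - 2 * C2cov (P r K s).d * landauRad (P r K s).d (P r K s).L * Real.exp (δw * rC) * (cι * Mι) * (cH * MH))))))) / (rΦw / S))) *
      Kw r (jl r K s)) + (3 * (LK * (2 * ((ε₄e + B₀e * be) + B₀e * (4 * (C2cov (P r K s).d * Real.exp (2 * δ' * r₀e)) * (ε₄e + B₀e * be) ^ 2)))) /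
      (rΦe / S - 1) + Bd))) / (1 - δ) ≤ D r (lvl K s)) :
    ShellWeightBound l₀ T
      (fun K t τ => histWeight (ν true K t τ) (small K τ) (v true K t) (fun s => ε (K - lvl K s)))
      (fun K t τ => histWeight (ν false K t τ) (small K τ) (v false K t) (fun s => ε (K - lvl K s)))
      (fun K t τ => histShell (ν true K t τ) (small K τ) (v true K t) (v false K t) (fun s => ε (K - lvl K s)))
      (fun K t τ => histShell (ν false K t τ) (small K τ) (v false K t) (v true K t) (fun s => ε (K - lvl K s)))
      (fun K => ∑ s ∈ C K, D true (lvl K s) * geomWidth Cr θmin ϑ (lvl K s) +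
        ∑ s ∈ C K, D false (lvl K s) * geomWidth Cr θmin ϑ (lvl K s)) := by
  -- file 1‴: END-II (S99 f3b) ∘ S90 per `(r, K, t, s, τ)` at `lvl := lvl`, `ε := ε`, `ρ := geomWidth Cr θmin ϑ`
  have hlive := hac_live_of_assembled_decay_histories_cfB7 P jl (fun _ => lvl) (ε := fun _ => ε) (ρ := fun _ j => geomWidth Cr θmin ϑ j) hη (fun _ a
    => hε a) (fun _ j => geomWidth_nonneg hCr hmin.le hϑ0.le j) hn hN Λ hΛbox hΛcomb e hS hSπ hF hFi hu hui hPu W Jco 𝒢 W𝒱 h𝒢 hW hB₀ hC₄ hε₄ hdL hC₁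
    hε₁ hB₃ h1 h2 h3 H₁ hH₁ Φ hΦd hΦ0 hΦ hSr k Sf Sf' Sw Sw' Se Se' Ubg hUbg hα hα3 hα4 hα6 h52locw h52loce ϖe₁ ϖe₂ hϖe₁ hϖe₂ hreache ιs hι Hop hH h18
    hcoup h3R ℓs hκ hℓ hlen hκc hcurl hδw ϖw dis hϖw pos posz pos' posx posb k𝒢 kι kH kH₁ hc𝒢 hM𝒢 hk𝒢 hM𝒢' hcι hMι hkι hMι' hcH hMH hkH hMH' hcH₁ hMH₁
    hkH₁ hMH₁' W𝒱w h𝒢w hWw hB₀w hC₄w hε₄w hdomw hselfw hcontrw hH₁w Φw hΦdw hΦ0w hΦbw h2Sw hιw hHw hqw hRCw NW hlocW hreachW hreachC hsupp hqW hk Pw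
    ℓw suppw ϖPw hblindw hdepthw hϖPw hκwb hκcb hℓwb hcurlw hlenw 𝓡𝒴w h𝓡𝒴w 𝓡𝒵w 𝓡ℬw h𝒢rw hWrw hιrw hHrw hH₁rw hΦrw hskew Bp hBu hBd hd hdbar hKw hδ' hϖ
    𝒢e W𝒱e h𝒢e hWe hB₀e hC₄e hbe hε₄e hdome hselfe hcontre H₁e hH₁e Φe hΦde hΦ0e hΦbe hSre ιe hιe He hHe hqe hRCe I hrE hEd hEb he0 supp hblind ϖP
    hdepth hLK hK hcoupE hElb₁ μ hg Aex hBd0 hint hpos hA hElb₂ L 𝓡𝒵 𝓡ℬ h𝒢r hWr hιr hHr hH₁r hΦr hRdict hudict hJW hJ hJ1 hWS hδ0 hδ1 hs₁ ha hma (fun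
    _ K s => hsm K s) ha0 hrad hcover hcore hcollar (fun _ j => hρg j) hβ
  -- the KEPT set in threshold units: `{u < ε·η²} = {u∕η² < ε}`
  have hset : ∀ (r : Bool) (K : ℕ) (t : ℝ) (s : σ),
      {U : GaugeField (P r K s) (jl r K s) SU2 | u r K t s U < ε (K - lvl K s) * η r (jl r K s) ^ 2} =
        {U | u r K t s U / η r (jl r K s) ^ 2 < ε (K - lvl K s)} := fun r K t s => by
    ext U; simp only [Set.mem_setOf_eq]; rw [div_lt_iff₀ (pow_pos (hη r _) 2)]
  -- (M1) for the KEPT layer measure at the level constant, for every history in which the slot is live-small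
  have hlay : ∀ (r : Bool) (K : ℕ) (t : ℝ), |t| ≤ l₀ → ∀ s ∈ C K, ∀ τ ∈ T K, s ∈ small K τ →
      SlotAntiConcentration ((fieldMeasure (P r K s) (jl r K s) SU2).withDensity
        ({U | u r K t s U / η r (jl r K s) ^ 2 < ε (K - lvl K s)}.indicator (F r K t s τ)))
        (fun U => u r K t s U / η r (jl r K s) ^ 2) (ε (K - lvl K s)) (geomWidth Cr θmin ϑ (lvl K s)) (D r (lvl K s)) := by
    intro r K t ht s hs τ _ _
    have h := slotAntiConcentration_mono (geomWidth_nonneg hCr hmin.le hϑ0.le (lvl K s)) (hDslot r K t ht s hs) (hlive r K t s τ)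
    rwa [hset r K t s] at h
  -- S103a: transport to the `s`-small partial law on the common space (per run)
  have hac : ∀ r : Bool, ∀ K t, |t| ≤ l₀ → ∀ s ∈ C K,
      SlotAntiConcentration (partialLaw (T K) (ν r K t) (small K) (v r K t) (fun s' => ε (K - lvl K s')) s) (v r K t s)
        (ε (K - lvl K s)) (geomWidth Cr θmin ϑ (lvl K s)) (D r (lvl K s)) := fun r =>
    hac_histories_of_layers (Lay := fun K s => GaugeField (P r K s) (jl r K s) SU2) (π := π r) (hπ r)
      (u' := fun K t s U => u r K t s U / η r (jl r K s) ^ 2) (hread r)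
      (fun K t s τ => (fieldMeasure (P r K s) (jl r K s) SU2).withDensity
        ({U | u r K t s U / η r (jl r K s) ^ 2 < ε (K - lvl K s)}.indicator (F r K t s τ))) (hid r) (hlay r)
  -- S90 f3: the histories-road END-I with `LocalRate` BY NAME
  exact shellWeightBound_histories_age_of_localRate hloc hCr hϑ0 hϑ1 hmin hfloorN (hv true) (hv false) hsmall hRA hRB (hD0 true)
    (hD0 false) (hac true) (hac false) hw (hDbar true) (hDbar false)

end Summit.QuantumFields.BalabanUV.T4Continuum.ShellMeasureLiveEndOneCallHistories

end
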